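import Summits.Langlands.Langlands.Theses.ExteriorSquareAscent
import Literature.NumberTheory.Automorphic.PairLFunctionPolesEqConjOfArch
import Literature.NumberTheory.Automorphic.PairLFunctionPolesRepDataHolds
import Literature.NumberTheory.Automorphic.ArchRankinSelbergTestVector

/-!
# Sketch — crux-ideate `stmt-Langlands-19093` (PairLPoleJS), ideator 1, round 1

First lemmas of the two idea cards, plus the CHECKED composition "archimedean hypothesis `hX` in
ranks `≥ 3` ⟹ the crux" through the landed reductions (so both cards really conclude the crux by name).
-/

noncomputable section

open MeasureTheory Measure NumberField NumberField.mixedEmbedding IsDedekindDomain Set Filter Topology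
open scoped MatrixGroups ENNReal NNReal Classical ComplexConjugate

set_option linter.dupNamespace false

namespace Summit.Langlands.Langlands.Cruxes.PairLPoleJS.Ideate1

open Literature.NumberTheory.Automorphic

/-! ### 0. The crux is the archimedean convergence `hX` in ranks `≥ 3` (composition through the tree) -/

/-- Both cards target the in-tree hypothesis `JacquetShalika1990_archRankinSelbergLIntegral_lt_top n K`
(`Ψ_∞(1; W_e, W̄_e, Φ_Gauss) < ∞` for every irreducible unitary `τ` of `GL_n(K_∞)`, continuous Whittaker
functional `ℓ`, Gårding `e`) in ranks `n ≥ 3`; the rest is landed: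
`…_of_archRankinSelbergLIntegral_lt_top_of_two_lt` (ranks `≤ 2` unconditional) →
`…_pole_repData_of_rank` → the crux (definitionally the named fact, `Iff.rfl`). -/
theorem PairLPoleJS_of_archConvergence
    (hX : ∀ (n : ℕ) (K : Type) [Field K] [NumberField K], 2 < n →
      JacquetShalika1990_archRankinSelbergLIntegral_lt_top n K) :
    Summit.Langlands.Langlands.Theses.ExteriorSquareAscent.PairLPoleJS :=
  JacquetShalika1981_partialPairL_pole_repData_of_rank fun n F _ _ μ _ =>
    JacquetShalika1981_partialPairL_pole_of_eq_conj_of_archRankinSelbergLIntegral_lt_top_of_two_lt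
      (μ := μ) (hX n F)

/-! ### Card `landau-local-zeta` — first lemma: Landau's lemma for one-sided Laplace transforms of
positive measures (the integral twin of the tree's `LandauGeneralizedDirichlet.summable_of_differentiableOn_ball`). -/

/-- **Landau for Laplace integrals of a non-negative density.** `Z(s) = ∫ G(x) e^{-ℓ(x) s} dm`, `G, ℓ ≥ 0`,
absolutely convergent at the real point `σ₁`; if `Z` agrees near a real `σ₂ > σ₁` with a function holomorphic
on the ball `B(σ₂, R)`, then the integral converges absolutely at every real `σ > σ₂ - R`
(the abscissa of convergence is a singularity). To be proved (adapt the discrete proof). -/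
theorem stub_landau_laplace {X : Type*} [MeasurableSpace X] (m : Measure X) [SFinite m]
    {G ℓ : X → ℝ} (hG : ∀ x, 0 ≤ G x) (hℓ : ∀ x, 0 ≤ ℓ x) (hGm : Measurable G) (hℓm : Measurable ℓ)
    {σ₁ σ₂ R : ℝ} (h₁ : Integrable (fun x => G x * Real.exp (-(ℓ x * σ₁))) m) (h12 : σ₁ < σ₂)
    {Φ : ℂ → ℂ} (hΦ : DifferentiableOn ℂ Φ (Metric.ball (σ₂ : ℂ) R))
    (hagree : Φ =ᶠ[𝓝 (σ₂ : ℂ)] fun s => ∫ x, (G x : ℂ) * Complex.exp (-((ℓ x : ℂ) * s)) ∂m)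
    {σ : ℝ} (hσ : σ₂ - R < σ) :
    Integrable (fun x => G x * Real.exp (-(ℓ x * σ))) m := by
  sorry

/-- **Card `landau-local-zeta` — the archimedean input it consumes (Jacquet 2009, Thm. 2.3 + the pole
location of `L(s, π_∞ × π̃_∞)` for unitary generic `π_∞`, Jacquet–Shalika I Cor. (2.5)), in the currency of
the tree's pair integral:** for `τ` irreducible unitary, `ℓ` a continuous Whittaker functional and a Gårding
`e`, the complex zeta integral `s ↦ Ψ_∞(s; W_e, W̄_e, Φ_Gauss)` agrees on some right half-plane with
`h(s) · ∏ Γ_ℝ(s + a_j) ∏ Γ_ℂ(s + b_j)`, `h` ENTIRE, all shifts with real part `> -1`, the integral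
converging absolutely at the real points of that half-plane (no Bochner junk). (Named-fact shape; with
`stub_landau_laplace` it yields `hX`, see the card.) -/
def JacquetArchRS_meromorphy_gauss (n : ℕ) (K : Type) [Field K] [NumberField K] : Prop :=
  ∀ (hcpt : isCompact_glFiniteIntegralLevel n K)
    (E : Type) [NormedAddCommGroup E] [InnerProductSpace ℂ E] [CompleteSpace E]
    (τ : ContRepresentation ℂ (AutomorphyDatum.gl n K hcpt).arch.carrier E) (hτ : τ.IsStronglyContinuous)
    (_ : τ.IsUnitary) (_ : τ.IsTopIrreducible)
    (ℓ : archGardingSpace hcpt τ →ₗ[ℂ] ℂ) (_ : IsArchContWhittakerFunctional hcpt τ hτ ℓ)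
    (e : archGardingSpace hcpt τ)
    [MeasurableSpace (GL (Fin n) (mixedSpace K))] [BorelSpace (GL (Fin n) (mixedSpace K))]
    [MeasurableSpace ((mixedSpace K)ˣ)] [BorelSpace ((mixedSpace K)ˣ)]
    (μA : Measure (Fin n → (mixedSpace K)ˣ)) (_ : IsHaarMeasure μA)
    (μK : Measure ↥(Kinf n K)) (_ : IsHaarMeasure μK),
    ∃ (σ₀ : ℝ) (h : ℂ → ℂ) (_ : Differentiable ℂ h) (d₁ d₂ : ℕ) (a : Fin d₁ → ℂ) (b : Fin d₂ → ℂ)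
      (_ : ∀ j, -1 < (a j).re) (_ : ∀ j, -1 < (b j).re),
      (∀ σ : ℝ, σ₀ < σ →
        ∫⁻ p : (Fin n → (mixedSpace K)ˣ) × ↥(Kinf n K),
          ‖ℓ ⟨τ (toArch hcpt (glDiagonal n (mixedSpace K) p.1 * (p.2 : GL (Fin n) (mixedSpace K)))) (e : E),
              apply_mem_archGardingSpace hτ _ e.2⟩‖ₑ ^ 2 *
            ENNReal.ofReal (gaussArchTestFun n K (archLastRow n K
                (glDiagonal n (mixedSpace K) p.1 * (p.2 : GL (Fin n) (mixedSpace K)))) *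
              archTorusWeight n K σ p.1) ∂(μA.prod μK) < ⊤) ∧
      ∀ s : ℂ, σ₀ < s.re →
        archRankinSelbergPairIntegralCplx hcpt τ hτ τ hτ ℓ ℓ e e
            (fun z => (gaussArchTestFun n K z : ℂ)) μA μK s =
          h s * ((∏ j, Complex.Gammaℝ (s + a j)) * ∏ j, Complex.Gammaℂ (s + b j))

/-! ### Card `dilation-coefficient-decay` — first lemma: strict (better-than-Howe–Moore–Oh) decay of the
matrix coefficients of a GENERIC irreducible unitary representation along the ray `diag(t, 1, …, 1, t⁻¹)`. -/

variable {K : Type} [Field K] [NumberField K]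

/-- The real scalar `t ∈ ℝˣ` as a unit of `K_∞ = mixedSpace K` (diagonally at every archimedean place). -/
def realScalarUnit (t : ℝˣ) : (mixedSpace K)ˣ :=
  Units.map (algebraMap ℝ (mixedSpace K)).toMonoidHom t

/-- The torus ray `a(t) = diag(t, 1, …, 1, t⁻¹)` in `GL_{m+1}` (as a tuple of diagonal units). -/
def rayTorus (m : ℕ) (t : ℝˣ) : Fin (m + 1) → (mixedSpace K)ˣ :=
  Function.update (Function.update (fun _ => 1) 0 (realScalarUnit t)) (Fin.last m) (realScalarUnit t)⁻¹

open scoped InnerProductSpace in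
/-- **Strict ray decay for generic unitary representations of `GL_{m+1}(K_∞)`, `m ≥ 2`** (the kernel input
of card `dilation-coefficient-decay`; its CLOSED form `η = 0` with a log is Howe–Moore–Oh uniform decay, free
in these property-(T) ranks; the `η > 0` is genericity = Jacquet–Shalika I Cor. (2.5)): for `τ` irreducible
unitary carrying a NON-ZERO continuous Whittaker functional and Gårding `e, e'`,
`|⟪τ(a(t)) e, e'⟫| ≤ C t^{-(1+η)}` for `t ≥ 1`, some `η > 0`. -/
def genericUnitary_strictRayDecay (m : ℕ) (K : Type) [Field K] [NumberField K] : Prop :=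
  2 ≤ m → ∀ (hcpt : isCompact_glFiniteIntegralLevel (m + 1) K)
    (E : Type) [NormedAddCommGroup E] [InnerProductSpace ℂ E] [CompleteSpace E]
    (τ : ContRepresentation ℂ (AutomorphyDatum.gl (m + 1) K hcpt).arch.carrier E) (hτ : τ.IsStronglyContinuous)
    (_ : τ.IsUnitary) (_ : τ.IsTopIrreducible)
    (ℓ : archGardingSpace hcpt τ →ₗ[ℂ] ℂ) (_ : IsArchContWhittakerFunctional hcpt τ hτ ℓ) (_ : ℓ ≠ 0)
    (e e' : archGardingSpace hcpt τ),
    ∃ (C η : ℝ), 0 < η ∧ ∀ t : ℝˣ, 1 ≤ (t : ℝ) →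
      ‖⟪τ (toArch hcpt (glDiagonal (m + 1) (mixedSpace K) (rayTorus (K := K) m t))) (e : E), (e' : E)⟫_ℂ‖ ≤
        C * (t : ℝ) ^ (-(1 + η))

end Summit.Langlands.Langlands.Cruxes.PairLPoleJS.Ideate1

end
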